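import Summits.NavierStokesRegularity.NavierStokesRegularity.Theses.HardyPointSink
import Summits.NavierStokesRegularity.NavierStokesRegularity.Theorems.HardyPointSinkHardyAncientLimitAssemblyB
import Summits.NavierStokesRegularity.NavierStokesRegularity.Theorems.HardyPointSinkHardyAncientLimitTypeIZoom
import Literature.Analysis.FluidPDE.NSViscosityRescaling
import Literature.Analysis.FluidPDE.NSLerayHopfABCScaling
import Literature.Analysis.FluidPDE.LocalTypeIScaling
import HarnessLib

/-!
# Route HardyPointSink — `HardyAncientLimit`: the closing theorem

Closes item stmt-NavierStokesRegularity-9138 (`HardyAncientLimit`) of route `HardyPointSink`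
(problem `NavierStokesRegularity`): `hardyAncientLimit_proof`.

Given a classical, Leray–Hopf solution `(u, p)` of the Navier–Stokes system with viscosity `ν`
on `[0, T) × ℝ³`, a backward singular point `(T, xs)` and a local Hardy bound
`∫_{B(xs,r₀)} |u(t,x)|² / |x - x₀| dx ≤ K` near `(T, xs)`, there is a bounded, non-trivial,
classical ancient solution `(U, P)` with viscosity `1` on `]-∞, 0[ × ℝ³` with Albritton–Barker's
`𝐈 < ∞` and Hardy energies bounded about every centre. Steps: (i) the viscosity is normalised to
`1` by `v(s, x) = ν⁻¹ u(s/ν, x)` (Tao's rescaling; the singular point becomes `(νT, xs)`, the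
Hardy constant `K/ν²`) — `hardyAncientLimit_of_one`; (ii) zooming in on the vertex with
`c = min(r₀, √T)` gives the zoomed pair `(u₁, p₁)` on `]-1, 0[ × ℝ³`, singular at the origin, of
finite Type I quantity on `Q(0, 1/2)` (`typeIBound_zoom_lt_top`, Albritton–Barker 2019,
Lemma 2.6 after Seregin) and with Hardy energies bounded on `B(0, r₀/c)`; (iii) the blow-up and
the limit are `HardyAncientLimit.exists_ancient_of_zoomed`.

## References

* D. Albritton, T. Barker, arXiv:1811.00502, Thm. 1.1, Lemma 2.6, §3.
* G. Seregin, V. Šverák, Comm. PDE 34 (2009), §4.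
* T. Tao, *Localisation and compactness …*, Anal. PDE 6 (2013), footnote 3 (viscosity scaling).
-/

noncomputable section

open Literature.Analysis.FluidPDE Literature.Analysis.FluidPDE.SereginSverak2009
open MeasureTheory Set Function Filter Topology Metric TopologicalSpace
open scoped ENNReal NNReal

namespace Summit.NavierStokesRegularity.NavierStokesRegularity.Theorems

namespace HardyAncientLimit

/-! ### Viscosity `1` -/

/-- **`HardyAncientLimit` for viscosity `1`.** Zoom in on the vertex `(T, xs)` with
`c = min(r₀, √T)`: the zoomed pair is classical on `]-1, 0[`, singular at the origin
(`eLpNorm_zoom_parabolicCylinder_eq_top`), of finite Type I quantity on `Q(0, 1/2)`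
(`typeIBound_zoom_lt_top`), with Hardy energies bounded on `B(0, r₀/c)` (scale invariance,
`lintegral_hardy_zoom`); conclude by `exists_ancient_of_zoomed`.
[cite: AlbrittonBarker2019, Thm. 1.1, Lemma 2.6, §3] -/
theorem exists_ancient_of_one {T : ℝ}
    {u : ℝ → EuclideanSpace ℝ (Fin 3) → EuclideanSpace ℝ (Fin 3)}
    {p : ℝ → EuclideanSpace ℝ (Fin 3) → ℝ} (hT : 0 < T)
    (hsol : IsClassicalNSSolutionOn (Ico 0 T) 1 0 u p) (hLH : IsLerayHopfOn T 1 0 (u 0) u)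
    {xs : EuclideanSpace ℝ (Fin 3)}
    (hsing : ∀ r : ℝ, 0 < r → eLpNorm (uncurry u) ⊤
      (volume.restrict (parabolicCylinder r ((T, xs) : ℝ × EuclideanSpace ℝ (Fin 3)))) = ⊤)
    {r₀ : ℝ} {K : ℝ≥0} (hr₀ : 0 < r₀)
    (hH : ∀ x₀ ∈ ball xs r₀, ∀ t ∈ Ico 0 T, T - r₀ ^ 2 < t →
      ∫⁻ x in ball xs r₀, ‖u t x‖ₑ ^ 2 / ‖x - x₀‖ₑ ≤ K) :
    ∃ (U : ℝ → EuclideanSpace ℝ (Fin 3) → EuclideanSpace ℝ (Fin 3))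
      (P : ℝ → EuclideanSpace ℝ (Fin 3) → ℝ),
      IsClassicalNSSolutionOn (Iio 0) 1 0 U P ∧
      (∃ M : ℝ, ∀ t < 0, ∀ x : EuclideanSpace ℝ (Fin 3), ‖U t x‖ ≤ M) ∧
      (∃ t < 0, ∃ x : EuclideanSpace ℝ (Fin 3), U t x ≠ 0) ∧
      (⨆ (r : ℝ) (_ : 0 < r) (z : ℝ × EuclideanSpace ℝ (Fin 3))
          (_ : parabolicCylinder r z ⊆ Iio (0 : ℝ) ×ˢ (univ : Set (EuclideanSpace ℝ (Fin 3)))),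
        cknA r z U + cknC r z U +
          (ENNReal.ofReal r ^ 2)⁻¹ * (∫⁻ w in parabolicCylinder r z,
            ‖P w.1 w.2 - ⨍ y in ball z.2 r, P w.1 y‖ₑ ^ (3 / 2 : ℝ)) +
          cknE r z (fun t x => fderiv ℝ (U t) x)) < ⊤ ∧
      (∃ K : NNReal, ∀ x₀ : EuclideanSpace ℝ (Fin 3), ∀ t < 0,
        ∫⁻ x, ‖U t x‖ₑ ^ 2 / ‖x - x₀‖ₑ ≤ K) := by
  -- the zoom scale
  set c : ℝ := min r₀ (Real.sqrt T) with hc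
  have hc0 : 0 < c := lt_min hr₀ (Real.sqrt_pos.2 hT)
  have hcr : c ≤ r₀ := min_le_left _ _
  have hcT : c ^ 2 ≤ T := by
    have h1 : c ≤ Real.sqrt T := min_le_right _ _
    have h2 : c ^ 2 ≤ Real.sqrt T ^ 2 := pow_le_pow_left₀ hc0.le h1 2
    rwa [Real.sq_sqrt hT.le] at h2
  -- the zoomed pair
  set u₁ : ℝ → EuclideanSpace ℝ (Fin 3) → EuclideanSpace ℝ (Fin 3) := c • stPull (c ^ 2) c T xs u
    with hu₁
  set p₁ : ℝ → EuclideanSpace ℝ (Fin 3) → ℝ := c ^ 2 • stPull (c ^ 2) c T xs p with hp₁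
  set g : ℝ → ℝ := fun s => c ^ 2 * (p (T + c ^ 2 * s) 0 - normalisedPressure (u (T + c ^ 2 * s)) 0)
    with hg
  have hcl₁ : IsClassicalNSSolutionOn (Ioo (-1 : ℝ) 0) 1 0 u₁ p₁ := by
    refine (hsol.nsRescale_translate_zero hc0 T xs).mono (fun s hs => ?_) (uniqueDiffOn_Ioo _ _)
    show T + c ^ 2 * s ∈ Ico 0 T
    exact ⟨by nlinarith [hs.1], by nlinarith [hs.2, pow_pos hc0 2]⟩
  have hsing₁ : ¬ IsRegularAtOrigin u₁ :=
    not_isRegularAtOrigin_of_eLpNorm_eq_top fun r hr =>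
      eLpNorm_zoom_parabolicCylinder_eq_top hc0 hsing hr
  have hI : typeIBound (parabolicCylinder (1 / 2) (0 : ℝ × EuclideanSpace ℝ (Fin 3))) u₁
      (fun t x => p₁ t x - g t) (fun s y => fderiv ℝ (u₁ s) y) < ⊤ := by
    have h := typeIBound_zoom_lt_top hT hsol hLH hH hc0 hcr hcT
    have e : (c ^ 2 • stPull (c ^ 2) c T xs (fun t x => p t x - (p t 0 - normalisedPressure (u t) 0))) =
        fun t x => p₁ t x - g t := by
      funext s y
      simp only [hp₁, hg, Pi.smul_apply, stPull_apply, smul_eq_mul, mul_sub]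
    rw [e] at h
    exact h
  -- the Hardy bound in the zoomed frame
  have hR₀ : 1 ≤ r₀ / c := (one_le_div hc0).2 hcr
  have hH₁ : ∀ x₀ ∈ ball (0 : EuclideanSpace ℝ (Fin 3)) (r₀ / c), ∀ t ∈ Ioo (-1 : ℝ) 0,
      ∫⁻ x in ball (0 : EuclideanSpace ℝ (Fin 3)) (r₀ / c), ‖u₁ t x‖ₑ ^ 2 / ‖x - x₀‖ₑ ≤ K := by
    intro x₀ hx₀ t ht
    rw [hu₁, lintegral_hardy_zoom hc0, smul_zero, add_zero, mul_div_cancel₀ _ hc0.ne']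
    refine hH _ ?_ _ ⟨by nlinarith [ht.1], by nlinarith [ht.2, pow_pos hc0 2]⟩ ?_
    · rw [mem_ball_iff_norm, add_sub_cancel_left, norm_smul, Real.norm_eq_abs, abs_of_pos hc0]
      rw [mem_ball_zero_iff, lt_div_iff₀ hc0] at hx₀
      linarith
    · have : c ^ 2 ≤ r₀ ^ 2 := pow_le_pow_left₀ hc0.le hcr 2
      nlinarith [ht.1, pow_pos hc0 2]
  exact exists_ancient_of_zoomed hcl₁ hsing₁ hI hR₀ hH₁

/-! ### Viscosity normalisation -/

/-- **`L^∞` under an affine space–time change of variables**: for `α ≥ 0`, `β, γ > 0` and any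
`S`, `‖α u ∘ Φ‖_{L^∞(Φ⁻¹ S)} = α ‖u‖_{L^∞(S)}`, `Φ(s, y) = (t₀ + β s, x₀ + γ y)` (Lebesgue measure is
mapped to a multiple of itself). [folklore] -/
theorem eLpNorm_top_smul_stPull_preimage {α β γ : ℝ} (hα : 0 ≤ α) (hβ : 0 < β) (hγ : 0 < γ)
    (t₀ : ℝ) (x₀ : EuclideanSpace ℝ (Fin 3)) (S : Set (ℝ × EuclideanSpace ℝ (Fin 3)))
    (u : ℝ → EuclideanSpace ℝ (Fin 3) → EuclideanSpace ℝ (Fin 3)) :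
    eLpNorm (uncurry (α • stPull β γ t₀ x₀ u)) ∞ (volume.restrict (stAffine β γ t₀ x₀ ⁻¹' S)) =
      ENNReal.ofReal α * eLpNorm (uncurry u) ∞ (volume.restrict S) := by
  have hme := measurableEmbedding_stAffine (E := EuclideanSpace ℝ (Fin 3)) hβ.ne' hγ.ne' t₀ x₀
  rw [eLpNorm_exponent_top, eLpNorm_exponent_top, eLpNormEssSup_eq_essSup_enorm,
    eLpNormEssSup_eq_essSup_enorm]
  have hF : (fun w : ℝ × EuclideanSpace ℝ (Fin 3) => ‖uncurry (α • stPull β γ t₀ x₀ u) w‖ₑ) =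
      fun w => ENNReal.ofReal α *
        ((fun w' : ℝ × EuclideanSpace ℝ (Fin 3) => ‖uncurry u w'‖ₑ) ∘ stAffine β γ t₀ x₀) w := by
    funext ⟨s, y⟩
    simp only [uncurry_apply_pair, Pi.smul_apply, stPull_apply, enorm_smul, Real.enorm_eq_ofReal hα,
      Function.comp_apply, stAffine_apply]
  rw [hF, ENNReal.essSup_const_mul]
  congr 1
  have h2 := hme.essSup_map_measure (μ := volume.restrict (stAffine β γ t₀ x₀ ⁻¹' S))
    (g := fun w' : ℝ × EuclideanSpace ℝ (Fin 3) => ‖uncurry u w'‖ₑ)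
  rw [map_stAffine_volume_restrict_preimage hβ hγ, finrank_euclideanSpace_fin,
    essSup_ennreal_smul_measure (by simp; positivity)] at h2
  exact h2.symm

/-- **The singular point survives the viscosity normalisation**: if `u` is essentially unbounded
on every `Q_r(T, xs)`, then `v(s, x) = ν⁻¹ u(s/ν, x)` is essentially unbounded on every
`Q_r(νT, xs)` (each `Q_r(νT, xs)` contains the image of `Q_{r'}(T, xs)`, `r' = r/(1+√ν)`).
[folklore] -/
theorem eLpNorm_timeRescale_eq_top {ν T : ℝ} (hν : 0 < ν)
    {u : ℝ → EuclideanSpace ℝ (Fin 3) → EuclideanSpace ℝ (Fin 3)} {xs : EuclideanSpace ℝ (Fin 3)}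
    (hsing : ∀ r : ℝ, 0 < r → eLpNorm (uncurry u) ⊤
      (volume.restrict (parabolicCylinder r ((T, xs) : ℝ × EuclideanSpace ℝ (Fin 3)))) = ⊤)
    {r : ℝ} (hr : 0 < r) :
    eLpNorm (uncurry (timeRescale ν⁻¹ ν⁻¹ u)) ⊤
      (volume.restrict (parabolicCylinder r ((ν * T, xs) : ℝ × EuclideanSpace ℝ (Fin 3)))) = ⊤ := by
  have hsq : 0 < Real.sqrt ν := Real.sqrt_pos.2 hν
  set r' : ℝ := r / (1 + Real.sqrt ν) with hr'
  have h1s : 0 < 1 + Real.sqrt ν := by positivity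
  have hr'0 : 0 < r' := div_pos hr h1s
  have hr'r : r' ≤ r := div_le_self hr.le (by linarith)
  have hr'ν : ν * r' ^ 2 ≤ r ^ 2 := by
    have e : r = r' * (1 + Real.sqrt ν) := by rw [hr', div_mul_cancel₀ _ h1s.ne']
    have hs : Real.sqrt ν ^ 2 = ν := Real.sq_sqrt hν.le
    rw [e]
    nlinarith [sq_nonneg r', mul_pos hr'0 hsq, sq_nonneg (r' * Real.sqrt ν)]
  -- the preimage of `Q_{r'}(T, xs)` under `(s, y) ↦ (ν⁻¹ s, y)` lies in `Q_r(νT, xs)`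
  set S := parabolicCylinder r' ((T, xs) : ℝ × EuclideanSpace ℝ (Fin 3)) with hS
  have hsub : stAffine ν⁻¹ 1 0 0 ⁻¹' S ⊆
      parabolicCylinder r ((ν * T, xs) : ℝ × EuclideanSpace ℝ (Fin 3)) := by
    rintro ⟨s, y⟩ hw
    simp only [hS, mem_preimage, stAffine_apply, zero_add, one_smul, mem_parabolicCylinder] at hw
    rw [mem_parabolicCylinder]
    obtain ⟨⟨h1, h2⟩, h3⟩ := hw
    refine ⟨⟨?_, ?_⟩, lt_of_lt_of_le h3 hr'r⟩
    · have := (lt_inv_mul_iff₀ hν).1 h1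
      nlinarith
    · have := (inv_mul_lt_iff₀ hν).1 h2
      linarith
  have e : uncurry (timeRescale ν⁻¹ ν⁻¹ u) = uncurry (ν⁻¹ • stPull ν⁻¹ 1 0 0 u) := by
    funext ⟨s, y⟩
    simp only [uncurry_apply_pair, timeRescale_apply, Pi.smul_apply, stPull_apply, zero_add, one_smul]
  rw [e]
  refine eq_top_iff.2 ?_
  calc (⊤ : ℝ≥0∞) = ENNReal.ofReal ν⁻¹ * eLpNorm (uncurry u) ∞ (volume.restrict S) := by
        rw [hS, hsing r' hr'0, ENNReal.mul_top (by simpa using hν)]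
    _ = eLpNorm (uncurry (ν⁻¹ • stPull ν⁻¹ 1 0 0 u)) ∞ (volume.restrict (stAffine ν⁻¹ 1 0 0 ⁻¹' S)) :=
        (eLpNorm_top_smul_stPull_preimage (inv_nonneg.2 hν.le) (inv_pos.2 hν) one_pos 0 0 S u).symm
    _ ≤ _ := eLpNorm_mono_measure _ (Measure.restrict_mono hsub le_rfl)

end HardyAncientLimit

open HardyAncientLimit in
/-- **`HardyAncientLimit` holds** (closes item stmt-NavierStokesRegularity-9138 of route
`HardyPointSink`): from a classical Leray–Hopf solution with a backward singular point and a
local Hardy bound, the viscosity normalisation `v(s,x) = ν⁻¹ u(s/ν, x)` (classical on `[0, νT)`,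
Leray–Hopf, singular at `(νT, xs)`, Hardy constant `K/ν²` on the ball of radius
`r₀ √ν/(1+√ν)`) followed by `HardyAncientLimit.exists_ancient_of_one` produces the Hardy-bounded
Type I ancient profile. (The rapid decay of the datum is not needed.)
[cite: AlbrittonBarker2019, Thm. 1.1 and §3] -/
theorem hardyAncientLimit_proof :
    Summit.NavierStokesRegularity.NavierStokesRegularity.Theses.HardyPointSink.HardyAncientLimit := by
  intro ν T hν hT u p hsol hLH _ xs hsing r₀ K hr₀ hH
  -- the rescaled pair
  set v : ℝ → EuclideanSpace ℝ (Fin 3) → EuclideanSpace ℝ (Fin 3) := timeRescale ν⁻¹ ν⁻¹ u with hv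
  set q : ℝ → EuclideanSpace ℝ (Fin 3) → ℝ := timeRescale ν⁻¹ (ν⁻¹ ^ 2) p with hq
  have hνT : 0 < ν * T := mul_pos hν hT
  have hmaps : MapsTo (fun s => ν⁻¹ * s) (Ico 0 (ν * T)) (Ico 0 T) := by
    intro s hs
    refine ⟨mul_nonneg (inv_nonneg.2 hν.le) hs.1, ?_⟩
    have := mul_lt_mul_of_pos_left hs.2 (inv_pos.2 hν)
    rwa [inv_mul_cancel_left₀ hν.ne'] at this
  have hsolv : IsClassicalNSSolutionOn (Ico 0 (ν * T)) 1 0 v q := by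
    have h := hsol.viscosityRescale_set hν.ne' hmaps (uniqueDiffOn_Ico 0 (ν * T))
    rwa [timeRescale_zero_force] at h
  have hLHv : IsLerayHopfOn (ν * T) 1 0 (v 0) v := by
    have h := hLH.viscosityRescale (inv_pos.2 hν)
    rw [timeRescale_zero_force, inv_mul_cancel₀ hν.ne', div_inv_eq_mul, mul_comm] at h
    have e : v 0 = ν⁻¹ • u 0 := by
      funext x
      simp only [hv, timeRescale_apply, mul_zero, Pi.smul_apply]
    rw [e]
    exact h
  have hsingv : ∀ r : ℝ, 0 < r → eLpNorm (uncurry v) ⊤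
      (volume.restrict (parabolicCylinder r ((ν * T, xs) : ℝ × EuclideanSpace ℝ (Fin 3)))) = ⊤ :=
    fun r hr => eLpNorm_timeRescale_eq_top hν hsing hr
  -- the Hardy bound for `v`
  have hsq : 0 < Real.sqrt ν := Real.sqrt_pos.2 hν
  set r₁ : ℝ := r₀ * (Real.sqrt ν / (1 + Real.sqrt ν)) with hr₁
  have h1s : 0 < 1 + Real.sqrt ν := by positivity
  have hr₁0 : 0 < r₁ := mul_pos hr₀ (div_pos hsq h1s)
  have hr₁r₀ : r₁ ≤ r₀ := by
    have : Real.sqrt ν / (1 + Real.sqrt ν) ≤ 1 := (div_le_one h1s).2 (by linarith)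
    exact (mul_le_mul_of_nonneg_left this hr₀.le).trans_eq (mul_one _)
  have hr₁sq : r₁ ^ 2 ≤ ν * r₀ ^ 2 := by
    have hs : Real.sqrt ν ^ 2 = ν := Real.sq_sqrt hν.le
    have hratio : (Real.sqrt ν / (1 + Real.sqrt ν)) ^ 2 ≤ ν := by
      rw [div_pow, hs, div_le_iff₀ (by positivity)]
      nlinarith [hs, sq_nonneg (Real.sqrt ν)]
    calc r₁ ^ 2 = r₀ ^ 2 * (Real.sqrt ν / (1 + Real.sqrt ν)) ^ 2 := by rw [hr₁, mul_pow]
      _ ≤ r₀ ^ 2 * ν := by gcongr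
      _ = ν * r₀ ^ 2 := by ring
  have hHv : ∀ x₀ ∈ ball xs r₁, ∀ s ∈ Ico 0 (ν * T), ν * T - r₁ ^ 2 < s →
      ∫⁻ x in ball xs r₁, ‖v s x‖ₑ ^ 2 / ‖x - x₀‖ₑ ≤ (Real.toNNReal (ν⁻¹ ^ 2) * K : ℝ≥0) := by
    intro x₀ hx₀ s hs hs'
    have ht : ν⁻¹ * s ∈ Ico 0 T := hmaps hs
    have ht' : T - r₀ ^ 2 < ν⁻¹ * s := by
      rw [lt_inv_mul_iff₀ hν]
      nlinarith
    have hK := hH x₀ (ball_subset_ball hr₁r₀ hx₀) _ ht ht'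
    have e : ∀ x, ‖v s x‖ₑ ^ 2 / ‖x - x₀‖ₑ =
        ENNReal.ofReal (ν⁻¹ ^ 2) * (‖u (ν⁻¹ * s) x‖ₑ ^ 2 / ‖x - x₀‖ₑ) := by
      intro x
      simp only [hv, timeRescale_apply, enorm_smul, mul_pow, Real.enorm_eq_ofReal (inv_nonneg.2 hν.le),
        ENNReal.ofReal_pow (inv_nonneg.2 hν.le)]
      rw [mul_div_assoc]
    simp_rw [e]
    rw [lintegral_const_mul' _ _ ENNReal.ofReal_ne_top, ENNReal.coe_mul, ENNReal.ofReal]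
    gcongr
    exact (lintegral_mono_set (ball_subset_ball hr₁r₀)).trans hK
  exact exists_ancient_of_one hνT hsolv hLHv hsingv hr₁0 hHv

end Summit.NavierStokesRegularity.NavierStokesRegularity.Theorems

end
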